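import Literature.Probability.LatticeModels.PlaneRotatorShellDecay
import Literature.Probability.LatticeModels.LayeredPlaneRotatorDecoupling
import Literature.Probability.LatticeModels.PlaneRotatorLiebCriterion
import HarnessLib

/-!
# The open classical XY chain: `⟨cos(θ_a − θ_c)⟩ ≤ u(K)^{|a − c|}` with the two-spin value `u = I₁/I₀ < 1`, and the
# single-chain susceptibility bound `∑_x ⟨cos(θ_a − θ_x)⟩ ≤ (1 + u)/(1 − u)` at every temperature

Topic `Literature/Probability/LatticeModels`. A one-dimensional chain of plane rotators with nearest-neighbour
coupling `K = βJ` never orders: its two-point function decays like `u(K)^{|a−c|}`, `u(K) = I₁(K)/I₀(K) < 1`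
(the classical transfer-"matrix" value of one bond — M. E. Fisher's exact solution of the classical Heisenberg /
planar chain; for plane rotators E. H. Lieb, Comm. Math. Phys. 77 (1980) 127, eq. (25): the two-spin system has
`⟨σ_a·σ_b⟩ = I₁(β)/I₀(β)`), and the susceptibility of one chain is finite at every `T > 0`,
`χ₁(K) ≤ (1 + u)/(1 − u) ~ 4K` (`K → ∞`). This file proves the UPPER bounds, uniformly in the length of the chain
(free ends), in the vocabulary of `PlaneRotatorGinibreComparison.lean` (`twoPoint J a b = ⟨cos(θ_a − θ_b)⟩_{V,J}`,
couplings on ordered pairs, inverse temperature absorbed):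

* `besselRatio K = I₁(K)/I₀(K)` with `0 ≤ u < 1` (`besselRatio_nonneg`, `besselRatio_lt_one`; Amos' bound of
  `PlaneRotatorLiebCriterion.lean`);
* `chainSegCoupling n K lo hi` — the bonds `{i, i+1}` of `Fin (n+1)` with `lo ≤ i`, `i + 1 ≤ hi`, weight `K/2` on
  each orientation; `chainCoupling n K = chainSegCoupling n K 0 n` the open chain;
* `twoPoint_chainSeg_end_eq_besselRatio` — in the segment `[lo, m+1]` the LAST bond has
  `⟨cos(θ_m − θ_{m+1})⟩ = u(K)` exactly: the sites `lo, …, m−1` are stripped one by one as dangling leaves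
  (`twoPoint_add_leaf_eq` of `LayeredPlaneRotatorDecoupling.lean`) and the two-spin value is
  `twoPoint_starCoupling_eq` (`PlaneRotatorStarTwoPoint.lean`);
* `twoPoint_chain_le_pow` — **`⟨cos(θ_a − θ_c)⟩_{chain} ≤ u(K)^{|a − c|}`**: Lieb's separating inequality with the
  half-chain `[0, x+1]` as inside system and the single separating site `x + 1` (the shell theorem
  `twoPoint_le_pow_of_shell_rowSum_le` of `PlaneRotatorShellDecay.lean`, shell row value `u(K)` by the previous item);
* `sum_twoPoint_chain_le` — **the single-chain susceptibility bound** `∑_x ⟨cos(θ_a − θ_x)⟩ ≤ (1+u)/(1−u)`,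
  uniformly in `n` and `a` (two geometric series).

Use (cell `pub/hubbard-tc`, MO-S3): the in-fibre input of the quasi-one-dimensional («coupled chains / ladders»)
ordering lemma — strands of `layeredXYCoupling β J⊥ J∥` decouple at rate `2βJ⊥ χ₁(βJ∥)` per transverse step
(the strand-decoupling companion file, sibling of the layer decoupling `twoPoint_layered_le_pow_interlayer'`).
HONEST FRAMING: classical rotators, finite chains, upper bounds only (the equality `= u^{|a−c|}` on the full chain is
not needed and not proved); nothing here is a statement about a quantum ladder.

References: E. H. Lieb, Comm. Math. Phys. **77** (1980) 127–135, Theorem 4 and eq. (25) [Lieb1980]; J. Ginibre,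
Comm. Math. Phys. **16** (1970) 310, Prop. 3 / Example 4 [Ginibre1970]; D. E. Amos, Math. Comp. **28** (1974) 239,
eq. (11) [Amos1974]. Context (not cited by any declaration): D. J. Scalapino, Y. Imry, P. Pincus, Phys. Rev. B **11**
(1975) 2042 — the quasi-one-dimensional ordering heuristic `k_BT_c ≈ zJ⊥ χ_{1D}(T_c)` that this chain bound feeds,
in one-sided form, in the strand-decoupling companion file.
-/

noncomputable section

open MeasureTheory Finset
open scoped BigOperators

namespace Literature.Probability.LatticeModels

namespace PlaneRotator

/-! ### The two-spin value `u(K) = I₁(K)/I₀(K)` -/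

/-- The **two-spin value** `u(K) = I₁(K)/I₀(K)`: the two-point function of a single bond of strength `K`
(`twoPoint_starCoupling_eq`), Lieb's `⟨σ_a·σ_b⟩` for "the two-spin system consisting of `a` and `b` alone".
[cite: Lieb1980, Theorem 4 and eq. (25) (two-spin system, I₁(β)/I₀(β))] -/
def besselRatio (K : ℝ) : ℝ := besselI 1 K / besselI 0 K

/-- `u(0) = 0` (a switched-off bond). [cite: Lieb1980, eq. (25)] -/
theorem besselRatio_zero : besselRatio 0 = 0 := by
  simp [besselRatio, besselI_zero_right]

/-- `0 ≤ u(K)` for `K ≥ 0`. [cite: Lieb1980, eq. (25)] -/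
theorem besselRatio_nonneg {K : ℝ} (hK : 0 ≤ K) : 0 ≤ besselRatio K :=
  div_nonneg (besselI_nonneg hK 1) (besselI_nonneg hK 0)

/-- **`u(K) < 1` at every coupling** (`u(K) ≤ K/√(K² + 4)`, Amos): a single bond never aligns two rotators
perfectly — the reason a chain is disordered at every temperature. [cite: Amos1974, eq. (11) (m = 0)] -/
theorem besselRatio_lt_one {K : ℝ} (hK : 0 ≤ K) : besselRatio K < 1 := by
  rcases hK.eq_or_lt with h | h
  · rw [← h, besselRatio_zero]; exact one_pos
  · have hs : 0 < Real.sqrt (K ^ 2 + 4) := Real.sqrt_pos.2 (by positivity)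
    calc besselRatio K ≤ K / Real.sqrt (K ^ 2 + 4) := besselRatio_le h
      _ < 1 := by
        rw [div_lt_one hs]
        calc K = Real.sqrt (K ^ 2) := (Real.sqrt_sq h.le).symm
          _ < Real.sqrt (K ^ 2 + 4) := Real.sqrt_lt_sqrt (sq_nonneg _) (by linarith)

/-- `u(K) ≤ K/2` (the mean-field / Ward value). [cite: Amos1974, eq. (11) (m = 0)] -/
theorem besselRatio_le_half_mul {K : ℝ} (hK : 0 ≤ K) : besselRatio K ≤ K / 2 :=
  besselRatio_le_half hK

/-! ### The open chain on `Fin (n+1)` and its segments -/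

section Chain

variable [MeasurableSpace Circle] [BorelSpace Circle]

/-- The **segment `[lo, hi]` of the open XY chain** on the sites `0, …, n`: coupling `K/2` on each ORIENTED
nearest-neighbour pair `(i, i+1)`, `(i+1, i)` with `lo ≤ i` and `i + 1 ≤ hi` (so the Gibbs weight is
`exp(K ∑_{lo ≤ i < hi} cos(θ_i − θ_{i+1}))`), all other rotators free. [cite: Lieb1980, eqs. (4)–(5) (H_A for a sub-system)] -/
def chainSegCoupling (n : ℕ) (K : ℝ) (lo hi : ℕ) (p : Fin (n + 1) × Fin (n + 1)) : ℝ :=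
  if (lo ≤ (p.1 : ℕ) ∧ (p.1 : ℕ) + 1 = p.2 ∧ (p.2 : ℕ) ≤ hi) ∨
      (lo ≤ (p.2 : ℕ) ∧ (p.2 : ℕ) + 1 = p.1 ∧ (p.1 : ℕ) ≤ hi) then K / 2 else 0

/-- The **open XY chain** of `n + 1` rotators with nearest-neighbour coupling `K` (free ends): the full segment
`[0, n]`. [cite: Lieb1980, Theorem 4 (nearest-neighbour rotators)] -/
def chainCoupling (n : ℕ) (K : ℝ) : Fin (n + 1) × Fin (n + 1) → ℝ := chainSegCoupling n K 0 n

variable {n : ℕ} {K : ℝ}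

omit [MeasurableSpace Circle] [BorelSpace Circle] in
/-- Segment couplings are non-negative for `K ≥ 0`. [cite: Ginibre1970, Example 4 (ferromagnetic plane rotators)] -/
theorem chainSegCoupling_nonneg (hK : 0 ≤ K) (lo hi : ℕ) (p : Fin (n + 1) × Fin (n + 1)) :
    0 ≤ chainSegCoupling n K lo hi p := by
  unfold chainSegCoupling
  split_ifs
  · positivity
  · exact le_rfl

omit [MeasurableSpace Circle] [BorelSpace Circle] in
/-- The chain couplings are non-negative for `K ≥ 0`. [cite: Ginibre1970, Example 4 (ferromagnetic plane rotators)] -/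
theorem chainCoupling_nonneg (hK : 0 ≤ K) (p : Fin (n + 1) × Fin (n + 1)) : 0 ≤ chainCoupling n K p :=
  chainSegCoupling_nonneg hK 0 n p

omit [MeasurableSpace Circle] [BorelSpace Circle] in
/-- A segment bond joins nearest neighbours inside `[lo, hi]`. [cite: Lieb1980, eqs. (4)–(5)] -/
theorem chainSegCoupling_ne_zero {lo hi : ℕ} {p : Fin (n + 1) × Fin (n + 1)}
    (hp : chainSegCoupling n K lo hi p ≠ 0) :
    (lo ≤ (p.1 : ℕ) ∧ (p.1 : ℕ) + 1 = p.2 ∧ (p.2 : ℕ) ≤ hi) ∨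
      (lo ≤ (p.2 : ℕ) ∧ (p.2 : ℕ) + 1 = p.1 ∧ (p.1 : ℕ) ≤ hi) := by
  unfold chainSegCoupling at hp
  by_contra h
  exact hp (if_neg h)

omit [MeasurableSpace Circle] [BorelSpace Circle] in
/-- **Stripping the left end**: the segment `[lo, hi]` is the segment `[lo+1, hi]` plus the single bond
`{lo, lo+1}` (both orientations), `lo + 1 ≤ hi`. [cite: Lieb1980, eqs. (4)–(5)] -/
theorem chainSegCoupling_eq_add_endBond {lo hi : ℕ} (hlo : lo + 1 ≤ hi) :
    chainSegCoupling n K lo hi = chainSegCoupling n K (lo + 1) hi +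
      fun p => if ((p.1 : ℕ) = lo ∧ (p.2 : ℕ) = lo + 1) ∨ ((p.2 : ℕ) = lo ∧ (p.1 : ℕ) = lo + 1)
        then K / 2 else 0 := by
  funext p
  simp only [chainSegCoupling, Pi.add_apply]
  split_ifs <;> first | rfl | (simp; done) | (exfalso; omega)

/-- **Dangling ends do not change the correlations of the rest**: for `a, b ≥ lo + 1` the two-point functions of
the segments `[lo, hi]` and `[lo+1, hi]` agree (the site `lo` is a leaf hanging from `lo + 1`;
`twoPoint_add_leaf_eq`). [cite: Ginibre1970, Example 4 with Prop. 3 (plane rotators; free ends)] -/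
theorem twoPoint_chainSeg_strip {lo hi : ℕ} (hlo : lo + 1 ≤ hi) (hhi : hi ≤ n) {a b : Fin (n + 1)}
    (ha : lo + 1 ≤ (a : ℕ)) (hb : lo + 1 ≤ (b : ℕ)) :
    twoPoint (chainSegCoupling n K lo hi) a b = twoPoint (chainSegCoupling n K (lo + 1) hi) a b := by
  classical
  have hf : lo + 1 < n + 1 := by omega
  set f : Fin (n + 1) := ⟨lo + 1, hf⟩ with hfdef
  set L : Finset (Fin (n + 1)) := Finset.univ.filter fun i => lo + 1 ≤ (i : ℕ) with hL
  have hmemL : ∀ i : Fin (n + 1), i ∈ L ↔ lo + 1 ≤ (i : ℕ) := fun i => by simp [hL]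
  rw [chainSegCoupling_eq_add_endBond hlo]
  refine twoPoint_add_leaf_eq (L := L) (foot := fun _ => f) (fun v _ => (hmemL f).2 (by simp [hfdef]))
    (fun p hp => ?_) (fun p hp => ?_) ((hmemL a).2 ha) ((hmemL b).2 hb)
  · rcases chainSegCoupling_ne_zero hp with ⟨h1, h2, -⟩ | ⟨h1, h2, -⟩
    · exact ⟨(hmemL _).2 h1, (hmemL _).2 (by omega)⟩
    · exact ⟨(hmemL _).2 (by omega), (hmemL _).2 h1⟩
  · have hp' : ((p.1 : ℕ) = lo ∧ (p.2 : ℕ) = lo + 1) ∨ ((p.2 : ℕ) = lo ∧ (p.1 : ℕ) = lo + 1) := by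
      by_contra h; exact hp (if_neg h)
    rcases hp' with ⟨h1, h2⟩ | ⟨h1, h2⟩
    · left
      exact ⟨fun h => by have := (hmemL _).1 h; omega, Fin.ext (by simp [hfdef, h2])⟩
    · right
      exact ⟨fun h => by have := (hmemL _).1 h; omega, Fin.ext (by simp [hfdef, h2])⟩

/-- **The last bond of a segment carries exactly the two-spin value**: in the segment `[lo, m+1]`,
`⟨cos(θ_m − θ_{m+1})⟩ = u(K)` — strip the sites `lo, …, m − 1` (`twoPoint_chainSeg_strip`), then the one-bond system
is the star of `m` and `twoPoint_starCoupling_eq` applies. (On a tree the correlation of adjacent rotators ignores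
the rest of the tree.) [cite: Lieb1980, Theorem 4 and eq. (25)] -/
theorem twoPoint_chainSeg_end_eq_besselRatio {lo m : ℕ} (hlo : lo ≤ m) (hm : m + 1 ≤ n) :
    twoPoint (chainSegCoupling n K lo (m + 1)) ⟨m, by omega⟩ ⟨m + 1, by omega⟩ = besselRatio K := by
  classical
  -- strip the left end `k` times: `[m - k, m+1] ↦ [m, m+1]`
  have hstrip : ∀ k lo', m = lo' + k →
      twoPoint (chainSegCoupling n K lo' (m + 1)) ⟨m, by omega⟩ ⟨m + 1, by omega⟩ =
        twoPoint (chainSegCoupling n K m (m + 1)) ⟨m, by omega⟩ ⟨m + 1, by omega⟩ := by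
    intro k
    induction k with
    | zero => intro lo' h; simp [h]
    | succ k ih =>
      intro lo' h
      rw [twoPoint_chainSeg_strip (lo := lo') (hi := m + 1) (by omega) (by omega) (by simp; omega)
        (by simp; omega)]
      exact ih (lo' + 1) (by omega)
  rw [hstrip (m - lo) lo (by omega)]
  -- the one-bond segment `[m, m+1]` is the star of `m`
  set x : Fin (n + 1) := ⟨m, by omega⟩ with hx
  set b : Fin (n + 1) := ⟨m + 1, by omega⟩ with hb
  have hstar : chainSegCoupling n K m (m + 1) = starCoupling (chainSegCoupling n K m (m + 1)) x := by
    funext p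
    simp only [starCoupling]
    split_ifs with h
    · rfl
    · unfold chainSegCoupling
      rw [if_neg]
      push Not at h
      rintro (⟨h1, h2, h3⟩ | ⟨h1, h2, h3⟩)
      · exact h.1 (Fin.ext (by simp [hx]; omega))
      · exact h.2 (Fin.ext (by simp [hx]; omega))
  rw [hstar, twoPoint_starCoupling_eq _ (show x ≠ b from fun h => by
    have := congrArg Fin.val h; simp [hx, hb] at this)]
  have hK : chainSegCoupling n K m (m + 1) (x, b) + chainSegCoupling n K m (m + 1) (b, x) = K := by
    simp [chainSegCoupling, hx, hb]
  rw [hK, besselRatio]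

/-- **Exponential decay along the open chain, towards the right end**:
`⟨cos(θ_a − θ_c)⟩_{chain} ≤ u(K)^{c − a}` (`K ≥ 0`; truncated subtraction, so the bound is `1` for `a > c`),
uniformly in the length `n`. Lieb's separating inequality with
the half-chain `[0, x+1]` as inside system and separating site `x + 1` for every `x < c` (shell row value `u(K)` by
`twoPoint_chainSeg_end_eq_besselRatio`), iterated by the floor-distance `c − x` (`twoPoint_le_pow_of_shell_rowSum_le`).
[cite: Lieb1980, Theorem 4 and eq. (23) (separating set; inside system)] -/
theorem twoPoint_chain_le_pow_sub (hK : 0 ≤ K) (a c : Fin (n + 1)) :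
    twoPoint (chainCoupling n K) a c ≤ besselRatio K ^ ((c : ℕ) - a) := by
  classical
  set J := chainCoupling n K with hJ
  set A : Fin (n + 1) → Finset (Fin (n + 1)) :=
    fun x => Finset.univ.filter fun i => ¬((x : ℕ) < c) ∨ (i : ℕ) ≤ x + 1 with hA
  set S : Fin (n + 1) → Finset (Fin (n + 1)) :=
    fun x => Finset.univ.filter fun i => (x : ℕ) < c ∧ (i : ℕ) = x + 1 with hS
  have hmemA : ∀ x i, i ∈ A x ↔ ¬((x : ℕ) < c) ∨ (i : ℕ) ≤ x + 1 := fun x i => by simp [hA]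
  have hmemS : ∀ x i, i ∈ S x ↔ (x : ℕ) < c ∧ (i : ℕ) = x + 1 := fun x i => by simp [hS]
  have h := twoPoint_le_pow_of_shell_rowSum_le (J := J) (chainCoupling_nonneg hK) A S
    (fun x i hi => (hmemA x i).2 (Or.inr (le_of_eq ((hmemS x i).1 hi).2)))
    (fun x => (hmemA x x).2 (Or.inr (Nat.le_succ _)))
    (fun x p hp => ?_) (s := besselRatio K) (fun x => ?_) c (d := fun x => (c : ℕ) - x)
    (fun x hx hcA => ?_) (fun x b hb => ?_) a
  · simpa using h
  · -- range: no bond joins the interior `[0, x]` to the outside of `[0, x+1]`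
    rcases chainSegCoupling_ne_zero hp with ⟨-, h2, -⟩ | ⟨-, h2, -⟩ <;>
    · constructor <;>
      · intro h1 h3
        rw [hmemA] at h1 h3
        rw [hmemS]
        omega
  · -- shell row sums
    by_cases hxc : (x : ℕ) < c
    · have hx1 : (x : ℕ) + 1 < n + 1 := by omega
      have hSx : S x = {⟨(x : ℕ) + 1, hx1⟩} := by
        ext i
        rw [hmemS, Finset.mem_singleton, Fin.ext_iff]
        simp [hxc]
      -- the inside system of `[0, x+1]` with shell `{x+1}` is the segment `[0, x+1]`
      have hins : insideCoupling J (A x) (S x) = chainSegCoupling n K 0 ((x : ℕ) + 1) := by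
        funext p
        simp only [insideCoupling, hJ, chainCoupling, chainSegCoupling, hmemA, hmemS]
        have h2 : ((p.2 : Fin (n + 1)) : ℕ) ≤ n := Nat.lt_succ_iff.1 p.2.2
        have h1 : ((p.1 : Fin (n + 1)) : ℕ) ≤ n := Nat.lt_succ_iff.1 p.1.2
        split_ifs <;> first | rfl | omega
      rw [hins, hSx, Finset.sum_singleton]
      obtain ⟨m, hm⟩ := x
      simp only at hx1 ⊢
      exact (twoPoint_chainSeg_end_eq_besselRatio (n := n) (K := K) (lo := 0) (m := m) (Nat.zero_le _)
        (by omega)).le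
    · have hSx : S x = ∅ := by
        ext i; simp [hmemS, hxc]
      rw [hSx, Finset.sum_empty]
      exact besselRatio_nonneg hK
  · -- `c` in the inside system of `x < c` is the separating site
    have hxc : (x : ℕ) < c := by
      by_contra h0; apply hx; show (c : ℕ) - x = 0; omega
    rw [hmemA] at hcA
    rw [hmemS]
    omega
  · rw [hmemS] at hb
    show (c : ℕ) - x ≤ (c : ℕ) - b + 1
    omega

/-- **Exponential decay along the open chain**: `⟨cos(θ_a − θ_c)⟩_{chain} ≤ u(K)^{|a − c|}` for all sites `a, c`
of the open chain of any length (`K ≥ 0`; `|a − c| = (c − a) + (a − c)` in truncated arithmetic). Since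
`u(K) < 1` for every `K` (`besselRatio_lt_one`), the classical XY chain has no long-range order at any temperature.
[cite: Lieb1980, Theorem 4 and eq. (25)] -/
theorem twoPoint_chain_le_pow (hK : 0 ≤ K) (a c : Fin (n + 1)) :
    twoPoint (chainCoupling n K) a c ≤ besselRatio K ^ (((c : ℕ) - a) + ((a : ℕ) - c)) := by
  rcases le_total a c with h | h
  · have h0 : (a : ℕ) - c = 0 := Nat.sub_eq_zero_of_le h
    rw [h0, add_zero]
    exact twoPoint_chain_le_pow_sub hK a c
  · have h0 : (c : ℕ) - a = 0 := Nat.sub_eq_zero_of_le h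
    rw [h0, zero_add, twoPoint_comm]
    exact twoPoint_chain_le_pow_sub hK c a

omit [MeasurableSpace Circle] [BorelSpace Circle] in
/-- A finite geometric sum of a ratio `0 ≤ u < 1` is at most `1/(1 − u)`. [folklore] -/
private theorem geom_sum_le_inv {u : ℝ} (hu0 : 0 ≤ u) (hu1 : u < 1) (s : Finset ℕ) :
    ∑ k ∈ s, u ^ k ≤ 1 / (1 - u) := by
  have hsum : Summable fun k : ℕ => u ^ k := summable_geometric_of_lt_one hu0 hu1
  calc ∑ k ∈ s, u ^ k ≤ ∑' k, u ^ k := hsum.sum_le_tsum s fun k _ => pow_nonneg hu0 k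
    _ = 1 / (1 - u) := by rw [tsum_geometric_of_lt_one hu0 hu1, one_div]

/-- **The single-chain susceptibility is finite at every temperature, uniformly in the length**:
`∑_x ⟨cos(θ_a − θ_x)⟩_{chain} ≤ (1 + u(K))/(1 − u(K))` for every site `a` of the open chain of any length
(`∑_x u^{|a−x|} ≤ ∑_{k ≥ 0} u^k + ∑_{k ≥ 1} u^k`). With `u(K) ~ 1 − 1/(2K)` this is `~ 4K = 4J/T` — the `1/T`
growth of the classical-chain susceptibility that sets the quasi-one-dimensional ordering scale `zJ⊥χ₁(T_c) ≈ 1`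
(Scalapino–Imry–Pincus). [cite: Lieb1980, Theorem 4 and eq. (25)] -/
theorem sum_twoPoint_chain_le (hK : 0 ≤ K) (a : Fin (n + 1)) :
    ∑ x, twoPoint (chainCoupling n K) a x ≤ (1 + besselRatio K) / (1 - besselRatio K) := by
  classical
  set u := besselRatio K with hu
  have hu0 : 0 ≤ u := besselRatio_nonneg hK
  have hu1 : u < 1 := besselRatio_lt_one hK
  have h1u : 0 < 1 - u := by linarith
  -- pointwise decay bound
  have hpt : ∀ x : Fin (n + 1), twoPoint (chainCoupling n K) a x ≤ u ^ (((x : ℕ) - a) + ((a : ℕ) - x)) :=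
    fun x => twoPoint_chain_le_pow hK a x
  refine (Finset.sum_le_sum fun x _ => hpt x).trans ?_
  -- split the sites into `x ≤ a` and `a < x`
  set T₁ : Finset (Fin (n + 1)) := Finset.univ.filter fun x => (x : ℕ) ≤ a with hT₁
  set T₂ : Finset (Fin (n + 1)) := Finset.univ.filter fun x => (a : ℕ) < x with hT₂
  have hsplit : (Finset.univ : Finset (Fin (n + 1))) = T₁ ∪ T₂ := by
    ext x; simp [hT₁, hT₂]; omega
  have hdisj : Disjoint T₁ T₂ := by
    rw [Finset.disjoint_filter]; intro x _ h; omega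
  rw [hsplit, Finset.sum_union hdisj]
  -- left part: `k = a - x`
  have hleft : ∑ x ∈ T₁, u ^ (((x : ℕ) - a) + ((a : ℕ) - x)) ≤ 1 / (1 - u) := by
    have hinj : Set.InjOn (fun x : Fin (n + 1) => (a : ℕ) - x) T₁ := by
      intro x hx y hy hxy
      simp only [hT₁, Finset.coe_filter, Finset.mem_univ, true_and, Set.mem_setOf_eq] at hx hy
      exact Fin.ext (by simp only at hxy; omega)
    calc ∑ x ∈ T₁, u ^ (((x : ℕ) - a) + ((a : ℕ) - x))
        = ∑ x ∈ T₁, u ^ ((a : ℕ) - x) := Finset.sum_congr rfl fun x hx => by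
          simp only [hT₁, Finset.mem_filter, Finset.mem_univ, true_and] at hx
          rw [Nat.sub_eq_zero_of_le hx, zero_add]
      _ = ∑ k ∈ T₁.image fun x : Fin (n + 1) => (a : ℕ) - x, u ^ k := (Finset.sum_image hinj).symm
      _ ≤ 1 / (1 - u) := geom_sum_le_inv hu0 hu1 _
  -- right part: `k = x - a ≥ 1`, one factor `u` pulled out
  have hright : ∑ x ∈ T₂, u ^ (((x : ℕ) - a) + ((a : ℕ) - x)) ≤ u * (1 / (1 - u)) := by
    have hinj : Set.InjOn (fun x : Fin (n + 1) => (x : ℕ) - a - 1) T₂ := by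
      intro x hx y hy hxy
      simp only [hT₂, Finset.coe_filter, Finset.mem_univ, true_and, Set.mem_setOf_eq] at hx hy
      exact Fin.ext (by simp only at hxy; omega)
    calc ∑ x ∈ T₂, u ^ (((x : ℕ) - a) + ((a : ℕ) - x))
        = ∑ x ∈ T₂, u * u ^ ((x : ℕ) - a - 1) := Finset.sum_congr rfl fun x hx => by
          simp only [hT₂, Finset.mem_filter, Finset.mem_univ, true_and] at hx
          rw [Nat.sub_eq_zero_of_le hx.le, add_zero, ← pow_succ',
            show (x : ℕ) - a - 1 + 1 = (x : ℕ) - a by omega]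
      _ = u * ∑ x ∈ T₂, u ^ ((x : ℕ) - a - 1) := by rw [Finset.mul_sum]
      _ = u * ∑ k ∈ T₂.image fun x : Fin (n + 1) => (x : ℕ) - a - 1, u ^ k := by
          rw [Finset.sum_image hinj]
      _ ≤ u * (1 / (1 - u)) := mul_le_mul_of_nonneg_left (geom_sum_le_inv hu0 hu1 _) hu0
  calc _ ≤ 1 / (1 - u) + u * (1 / (1 - u)) := add_le_add hleft hright
    _ = (1 + u) / (1 - u) := by field_simp

end Chain

end PlaneRotator

end Literature.Probability.LatticeModels
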